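import Summits.BirchSwinnertonDyer.BirchSwinnertonDyer.Theorems.KatoDescentPotSupersingularReducibleKatoMemberOfValueInputsNodes
import Literature.NumberTheory.EllipticCurves.IwasawaAlgebraDivisibilityProofs
import HarnessLib

/-!
# The HULL of `Kato2004.MemberHullValueInputs` can be taken INSIDE `Λ`: on every pin of the member carrying a
# guarded `ZetaBody` lift, a value package with an abstract hull `j : 𝐇¹_Γ ↪ F` yields one with `F = Λ`,
# `z, λ ∈ Λ = ℤ_p⟦X⟧`, the SAME multiplier `λ` and the SAME `𝐇²`-side — Kato 13.14 / Bourbaki AC VII §4.2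
# read through the tree's rank-one reflexive-hull theorem (crux M stmt-BirchSwinnertonDyer-19196)

Cell `bsd-potss`, seat `bsd-potss-rkm` generation 10; ROUTE-FREE; `--supports stmt-BirchSwinnertonDyer-19196`.

After the value-guarded re-type (`Kato2004/MemberHullValueInputs.lean`, p527621; kernel
`…ReducibleKatoMemberOfValueInputsNodes`, p528760) the fields of the held transcription of crux M that are
still ABSTRACT witnesses are the hull `(F, j, finite_coker)` with `z, λ`, and the `𝐇²`-side.  This file shows
that the hull witnesses carry no freedom beyond an ideal of `Λ`: by `rank_iwasawaH1_eq_one_of_zetaBody`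
(p528760) `rank_Λ 𝐇¹_Γ = 1` on the pin, so `rank_Λ F = 1` (finite cokernel), `F ≃ₗ 𝔟_F ≤ Λ` with `Λ ⧸ 𝔟_F`
finite (`IwasawaAlgebra.exists_linearEquiv_ideal_finite_quotient`, cell `bsd-cn100`), and transporting
`(j, z)` along `F ≃ 𝔟_F ⊆ Λ` keeps `j 𝐲 = λ • z`, keeps the cokernel finite (finite-by-finite, index calculus)
and can only ENLARGE the lengths `ℓ_𝔮(F ⧸ Λz) ≤ ℓ_𝔮(Λ ⧸ Λz′)` (an injection `F/Λz ↪ Λ/Λz′`), so Thm. 12.5 (3)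
off `(p)` survives verbatim:
* §1 `finite_quotient_range_subtype_comp` — index calculus: `Λ ⧸ range(ι_𝔟 ∘ e ∘ j)` is finite when
  `F ⧸ range j` and `Λ ⧸ 𝔟` are (`AddSubgroup.relIndex_mul_index`);
  `lengthAt_quotient_span_le_of_linearEquiv_ideal` — `ℓ_𝔮(F ⧸ Λz) ≤ ℓ_𝔮(Λ ⧸ Λ·e(z))`;
  `rank_eq_one_of_hull` — `rank F = rank H` for a hull.
* §2 **`MemberHullValueInputs.exists_ideal_hull`** — for `P : MemberHullValueInputs W p κ γ I 𝐲` on a pin with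
  `rank_Λ 𝐇¹_Γ = 1`: `∃ (j : 𝐇¹_Γ →ₗ[Λ] Λ) (z : Λ)`, `j` injective with `Λ ⧸ range j` finite, `j 𝐲 = P.lam • z`,
  and `ℓ_𝔮(P.H2) ≤ ℓ_𝔮(Λ ⧸ Λz)` at every height-one `𝔮 ≠ (p)`; **`…exists_ideal_hull_of_zetaBody`** — the same
  on every pin carrying a guarded `ZetaBody` lift (`W(ℚ)`, `Ш(W)[p^∞]` finite), rank discharged by p528760.

CONSEQUENCE (planner / typer; nothing edited here): a further re-type may replace the abstract hull
`(F, [inst], finite_F, torsionFree_F, j, j_injective, finite_coker, z)` by `(j : 𝐇¹_Γ →ₗ[Λ] Λ, j_injective,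
finite_coker, z : Λ)` — the divisibility clause then reads `ℓ_𝔮(𝐇²) ≤ ℓ_𝔮(Λ ⧸ (z))`, i.e. `char(𝐇²) ∣ (z)`
off `(p)`, the printed main-conjecture shape with a POWER SERIES `z`.  HONEST FRAMING: nothing is booked; the
fact stays a transcription of Kato Thm. 12.5 (3)/12.6/13.10 (1)/13.14/14.16 (2) + Wuthrich L.14; BSD is not
advanced.

References: K. Kato, Astérisque 295 (2004), 13.14 (p. 234), Thm. 12.5 (3) (p. 222) [Kato2004Asterisque];
N. Bourbaki, *AC* VII §4 no. 2 [BourbakiAC5to7]; C. Wuthrich, Doc. Math. 19 (2014) Lemma 12 [Wuthrich2014];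
tree `IwasawaAlgebraRankOneIdealProofs` (rank-one hull), `IwasawaAlgebraDivisibilityProofs` (`lengthAt` monotone).
-/

set_option autoImplicit false
set_option linter.dupNamespace false

noncomputable section

open scoped NumberField TensorProduct
open Field IsDedekindDomain CongruenceSubgroup Function
open Literature.NumberTheory.GaloisRepresentations
open Literature.NumberTheory.EllipticCurves Literature.NumberTheory.EllipticCurves.ModularForms
open Literature.NumberTheory.EllipticCurves.Kato2004
open Literature.NumberTheory.EllipticCurves.Kato2004.EulerSystemValues Rat.HeightOneSpectrum
open Literature.NumberTheory.EllipticCurves.IwasawaAlgebra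

namespace Summit.BirchSwinnertonDyer.BirchSwinnertonDyer.Theorems.MemberHullIdeal

/-! ## §1 Index calculus and lengths along `F ≃ 𝔟 ⊆ Λ` -/

section Algebra

variable (p : ℕ) [Fact p.Prime]

/-- **Finite-by-finite:** for `j : H → F` with `F ⧸ range j` finite and `e : F ≃ₗ 𝔟` onto an ideal `𝔟 ≤ Λ` of
finite index, the composite `ι_𝔟 ∘ e ∘ j : H → Λ` has finite cokernel `Λ ⧸ range(ι_𝔟 ∘ e ∘ j)`
(`index = relIndex · index`). [folklore] -/
theorem finite_quotient_range_subtype_comp {H F : Type*} [AddCommGroup H] [Module (IwasawaAlgebra p) H]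
    [AddCommGroup F] [Module (IwasawaAlgebra p) F] (j : H →ₗ[IwasawaAlgebra p] F)
    (hfin : Finite (F ⧸ LinearMap.range j)) (𝔟 : Submodule (IwasawaAlgebra p) (IwasawaAlgebra p))
    (e : F ≃ₗ[IwasawaAlgebra p] 𝔟) (h𝔟 : Finite (IwasawaAlgebra p ⧸ 𝔟)) :
    Finite (IwasawaAlgebra p ⧸ LinearMap.range (𝔟.subtype ∘ₗ (e : F →ₗ[IwasawaAlgebra p] 𝔟) ∘ₗ j)) := by
  set R : Submodule (IwasawaAlgebra p) (IwasawaAlgebra p) :=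
    LinearMap.range (𝔟.subtype ∘ₗ (e : F →ₗ[IwasawaAlgebra p] 𝔟) ∘ₗ j) with hR
  -- `R ≤ 𝔟`
  have hle : R.toAddSubgroup ≤ 𝔟.toAddSubgroup := by
    rintro x ⟨h, rfl⟩
    exact (e (j h)).2
  -- the inner range `range (e ∘ j) ≤ 𝔟` has finite index in `𝔟`: `𝔟 ⧸ range (e ∘ j) ≃ F ⧸ range j`
  set R' : Submodule (IwasawaAlgebra p) 𝔟 := LinearMap.range ((e : F →ₗ[IwasawaAlgebra p] 𝔟) ∘ₗ j)
    with hR'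
  have hmap : (LinearMap.range j).map (e : F →ₗ[IwasawaAlgebra p] 𝔟) = R' := by
    rw [hR', LinearMap.range_comp]
  have hfin' : Finite (𝔟 ⧸ R') :=
    Finite.of_equiv _ (Submodule.Quotient.equiv (LinearMap.range j) R' e hmap).toEquiv
  -- `R.addSubgroupOf 𝔟 = R'`
  have hof : R.toAddSubgroup.addSubgroupOf 𝔟.toAddSubgroup = R'.toAddSubgroup := by
    ext x
    simp only [AddSubgroup.mem_addSubgroupOf, Submodule.mem_toAddSubgroup, hR, hR', LinearMap.mem_range,
      LinearMap.coe_comp, Function.comp_apply, Submodule.coe_subtype]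
    constructor
    · rintro ⟨h, hh⟩
      exact ⟨h, Subtype.ext hh⟩
    · rintro ⟨h, hh⟩
      exact ⟨h, congrArg Subtype.val hh⟩
  -- indices
  haveI : (𝔟.toAddSubgroup).FiniteIndex := by
    haveI : Finite (IwasawaAlgebra p ⧸ 𝔟.toAddSubgroup) := h𝔟
    exact AddSubgroup.finiteIndex_of_finite_quotient
  have hrel : R.toAddSubgroup.relIndex 𝔟.toAddSubgroup ≠ 0 := by
    rw [AddSubgroup.relIndex, hof]
    haveI : Finite (𝔟 ⧸ R'.toAddSubgroup) := hfin'
    exact (AddSubgroup.finiteIndex_of_finite_quotient (H := R'.toAddSubgroup)).index_ne_zero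
  have hidx : R.toAddSubgroup.index ≠ 0 := by
    rw [← AddSubgroup.relIndex_mul_index hle]
    exact mul_ne_zero hrel AddSubgroup.FiniteIndex.index_ne_zero
  haveI : R.toAddSubgroup.FiniteIndex := AddSubgroup.finiteIndex_iff.mpr hidx
  exact AddSubgroup.finite_quotient_of_finiteIndex (H := R.toAddSubgroup)

/-- **Lengths can only grow along `F ≃ 𝔟 ⊆ Λ`:** `ℓ_𝔮(F ⧸ Λz) ≤ ℓ_𝔮(Λ ⧸ Λ·e(z))`, the induced map
`F ⧸ Λz → Λ ⧸ Λ·e(z)` being injective. [cite: BourbakiAC5to7, VII §4 no. 2] -/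
theorem lengthAt_quotient_span_le_of_linearEquiv_ideal {F : Type*} [AddCommGroup F]
    [Module (IwasawaAlgebra p) F] (𝔟 : Submodule (IwasawaAlgebra p) (IwasawaAlgebra p))
    (e : F ≃ₗ[IwasawaAlgebra p] 𝔟) (z : F) (𝔮 : PrimeSpectrum (IwasawaAlgebra p)) :
    Module.lengthAt (IwasawaAlgebra p) (F ⧸ (IwasawaAlgebra p) ∙ z) 𝔮 ≤
      Module.lengthAt (IwasawaAlgebra p)
        (IwasawaAlgebra p ⧸ (IwasawaAlgebra p) ∙ ((e z : 𝔟) : IwasawaAlgebra p)) 𝔮 := by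
  -- the map `F → Λ`, `f ↦ e f`, sends `Λz` into `Λ·e(z)`
  let φ : F →ₗ[IwasawaAlgebra p] IwasawaAlgebra p := 𝔟.subtype ∘ₗ (e : F →ₗ[IwasawaAlgebra p] 𝔟)
  have hφ : ∀ f : F, φ f = ((e f : 𝔟) : IwasawaAlgebra p) := fun f => rfl
  have hle : (IwasawaAlgebra p) ∙ z ≤ ((IwasawaAlgebra p) ∙ ((e z : 𝔟) : IwasawaAlgebra p)).comap φ := by
    rw [Submodule.span_singleton_le_iff_mem, Submodule.mem_comap, hφ]
    exact Submodule.mem_span_singleton_self _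
  refine Module.lengthAt_le_of_injective (Submodule.mapQ _ _ φ hle) ?_ 𝔮
  -- injectivity: `e f ∈ Λ·e(z)` forces `f ∈ Λz`
  rw [← LinearMap.ker_eq_bot, Submodule.mapQ, Submodule.ker_liftQ_eq_bot']
  ext f
  simp only [LinearMap.mem_ker, LinearMap.coe_comp, Function.comp_apply, Submodule.mkQ_apply,
    Submodule.Quotient.mk_eq_zero, Submodule.mem_span_singleton]
  constructor
  · rintro ⟨a, rfl⟩
    exact ⟨a, by rw [hφ, map_smul, Submodule.coe_smul]⟩
  · rintro ⟨a, ha⟩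
    refine ⟨a, e.injective (Subtype.ext ?_)⟩
    rw [map_smul, Submodule.coe_smul, ha, hφ]

/-- **A hull has the rank of the module:** for `j : H ↪ F` injective with finite cokernel,
`rank_Λ F = rank_Λ H`. [cite: BourbakiAC5to7, VII §4 no. 2] -/
theorem rank_eq_of_hull {H F : Type} [AddCommGroup H] [Module (IwasawaAlgebra p) H]
    [AddCommGroup F] [Module (IwasawaAlgebra p) F] (j : H →ₗ[IwasawaAlgebra p] F) (hj : Injective j)
    (hfin : Finite (F ⧸ LinearMap.range j)) :
    Module.rank (IwasawaAlgebra p) F = Module.rank (IwasawaAlgebra p) H :=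
  le_antisymm (MemberHullRankOne.rank_le_of_injective_of_finite_quotient p j hj hfin)
    (LinearMap.rank_le_of_injective j hj)

end Algebra

/-! ## §2 The hull of a value package inside `Λ` -/

section Pin

variable {W : WeierstrassCurve ℚ} [W.IsElliptic] {p : ℕ} [Fact p.Prime]
  [ContinuousSMul ℤ_[p] (W.tateModule p)] {κ : ZpExtension ℚ p} {γ : absoluteGaloisGroup ℚ}
  {I : IwasawaH1Data W p κ γ} {y : I.H}

/-- **The hull of a value package can be taken inside `Λ`, with the same multiplier and the same `𝐇²`-side.**
For `P : MemberHullValueInputs W p κ γ I 𝐲` on a pin with `rank_Λ 𝐇¹_Γ = 1`: there are an injective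
`j : 𝐇¹_Γ →ₗ[Λ] Λ` with `Λ ⧸ range j` finite and `z ∈ Λ` with `j 𝐲 = P.lam • z` and
`ℓ_𝔮(P.H2) ≤ ℓ_𝔮(Λ ⧸ Λz)` at every height-one `𝔮 ≠ (p)` (so every other field of `P` is kept verbatim).
Kato 13.14 via `IwasawaAlgebra.exists_linearEquiv_ideal_finite_quotient` applied to `P.F` (rank one by
`rank_eq_of_hull`), §1. [cite: Kato2004Asterisque, 13.14 (p. 234) and Thm. 12.5 (3) (p. 222)] [cite: BourbakiAC5to7, VII §4 no. 2] -/
theorem MemberHullValueInputs.exists_ideal_hull (P : MemberHullValueInputs W p κ γ I y)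
    (hrank : Module.rank (IwasawaAlgebra p) I.H = 1) :
    ∃ (j : I.H →ₗ[IwasawaAlgebra p] IwasawaAlgebra p) (z : IwasawaAlgebra p),
      Injective j ∧ Finite (IwasawaAlgebra p ⧸ LinearMap.range j) ∧ j y = P.lam • z ∧
      ∀ 𝔮 : PrimeSpectrum (IwasawaAlgebra p), 𝔮.asIdeal.height = 1 → 𝔮.asIdeal ≠ augIdealP p →
        Module.lengthAt (IwasawaAlgebra p) P.H2 𝔮 ≤
          Module.lengthAt (IwasawaAlgebra p) (IwasawaAlgebra p ⧸ (IwasawaAlgebra p) ∙ z) 𝔮 := by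
  haveI := P.finite_F
  haveI := P.torsionFree_F
  haveI : Module.IsTorsionFree (IwasawaAlgebra p) P.F :=
    Module.IsTorsionFree.of_smul_eq_zero fun r m h => smul_eq_zero.mp h
  have hF : Module.rank (IwasawaAlgebra p) P.F = 1 := by
    rw [MemberHullIdeal.rank_eq_of_hull p P.j P.j_injective P.finite_coker, hrank]
  obtain ⟨𝔟, h𝔟fin, -, ⟨e⟩⟩ := IwasawaAlgebra.exists_linearEquiv_ideal_finite_quotient hF
  refine ⟨𝔟.subtype ∘ₗ (e : P.F →ₗ[IwasawaAlgebra p] 𝔟) ∘ₗ P.j, ((e P.z : 𝔟) : IwasawaAlgebra p),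
    ?_, finite_quotient_range_subtype_comp p P.j P.finite_coker 𝔟 e h𝔟fin, ?_, ?_⟩
  · exact 𝔟.subtype_injective.comp (e.injective.comp P.j_injective)
  · simp only [LinearMap.coe_comp, Function.comp_apply, Submodule.coe_subtype, LinearEquiv.coe_coe, P.j_y,
      map_smul, Submodule.coe_smul]
  · intro 𝔮 h𝔮 h𝔮p
    exact (P.divisibility_offP 𝔮 h𝔮 h𝔮p).trans
      (lengthAt_quotient_span_le_of_linearEquiv_ideal p 𝔟 e P.z 𝔮)

end Pin

/-! ## §3 On the pins of the member fact -/

section Zeta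

variable {W : WeierstrassCurve ℚ} [W.IsElliptic] {p : ℕ} [Fact p.Prime]
  [ContinuousSMul ℤ_[p] (W.tateModule p)] [Module.Free ℤ_[p] (W.tateModule p)]
  [Module.Finite ℤ_[p] (W.tateModule p)] {N : ℕ} [NeZero N] {f : CuspForm (Gamma0 N) 2}
  {ι : (m : ℕ) → (CyclotomicField m ℚ →+* ℂ)} {κ' : ℝ}
  {Λ : ∀ (k : ℕ) (r : Finset (HeightOneSpectrum (𝓞 ℚ))),
    H1 (tateRep W p) (cycSubgroup p k r) →ₗ[ℤ_[p]] ℚ_[p] ⊗[ℚ] CyclotomicField (cycLevel p k r) ℚ}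
  {c d a : ℤ} {A : ℕ}
  {z : ∀ (k : ℕ) (r : (cyclotomicLevelsRat p (badPlaces c d A N)).Ideals),
    H1 (tateRep W p) ((cyclotomicLevelsRat p (badPlaces c d A N)).level k r.1)}
  {x : ∀ (k : ℕ) (r : (cyclotomicLevelsRat p (badPlaces c d A N)).Ideals),
    CyclotomicField (cycLevel p k r.1) ℚ}
  {V : WeierstrassCurve ℚ} [V.IsElliptic]
  {κ : ZpExtension ℚ p} {γ : absoluteGaloisGroup ℚ} {I : IwasawaH1Data W p κ γ} {y : I.H}

/-- **On every pin of the member carrying a guarded `ZetaBody` lift, the hull of a value package can be taken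
inside `Λ`** (`W(ℚ)`, `Ш(W)[p^∞]` finite; rank from `ReducibleOfValueInputs.rank_iwasawaH1_eq_one_of_zetaBody`).
[cite: Kato2004Asterisque, 13.14 (p. 234), Thm. 12.4 (2) (p. 221), Thm. 12.5 (3) (p. 222)] -/
theorem MemberHullValueInputs.exists_ideal_hull_of_zetaBody (P : MemberHullValueInputs W p κ γ I y)
    [Finite W.toAffine.Point] [Finite (AddCommGroup.primaryComponent W.sha p)]
    (hκ : κ.IsCyclotomic) (hγ : κ.IsTopGenerator γ) (hp : p ≠ 2)
    (hbody : ZetaBody W p f ι κ' Λ c d a A z x) (hκ' : κ' ≠ 0)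
    (hf : IsNewformOf V f) (hL1 : V.entireLFunction 1 ≠ 0) (hA : 0 < A) (d' : ℤ)
    (hcd : Int.gcd (c * d) A = 1) (hdd' : d * d' ≡ 1 [ZMOD (A : ℤ)])
    (hR : cuspFactor f true (fun _ ↦ 1) c d a A d' ≠ 0)
    (hy : ∀ n : ℕ, I.proj n y = levelToLayer W p hκ hp (badPlaces c d A N) n
      (z (n + 1) (cyclotomicLevelsRat p (badPlaces c d A N)).idealOne)) :
    ∃ (j : I.H →ₗ[IwasawaAlgebra p] IwasawaAlgebra p) (z₀ : IwasawaAlgebra p),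
      Injective j ∧ Finite (IwasawaAlgebra p ⧸ LinearMap.range j) ∧ j y = P.lam • z₀ ∧
      ∀ 𝔮 : PrimeSpectrum (IwasawaAlgebra p), 𝔮.asIdeal.height = 1 → 𝔮.asIdeal ≠ augIdealP p →
        Module.lengthAt (IwasawaAlgebra p) P.H2 𝔮 ≤
          Module.lengthAt (IwasawaAlgebra p) (IwasawaAlgebra p ⧸ (IwasawaAlgebra p) ∙ z₀) 𝔮 :=
  MemberHullIdeal.MemberHullValueInputs.exists_ideal_hull P
    (ReducibleOfValueInputs.rank_iwasawaH1_eq_one_of_zetaBody hκ hγ hp hbody hκ' hf hL1 hA d' hcd hdd' hR hy)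

end Zeta

end Summit.BirchSwinnertonDyer.BirchSwinnertonDyer.Theorems.MemberHullIdeal

end
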